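import Literature.Analysis.FluidPDE.PineauVicolRDSSLiouvilleHolds
import Literature.Analysis.FluidPDE.PineauVicolRSSProofs
import Literature.Analysis.FluidPDE.VectorCalculus
import HarnessLib

/-!
# Crux `FrequencyRigidity` (stmt-NavierStokesRegularity-2955), line `scaled-energy-split`:
# sub-goal of Stub 2 — the rotated DISCRETELY self-similar case in Pineau–Vicol's `λ ≈ 1` window

Helper file (`--supports stmt-NavierStokesRegularity-2955`; theorems only, sorry-free).  Stub
`stub_finiteRDSSExtremes`: for every decay constant `C₀ > 0` there are `α₁ > 0`, `c₁ > 1`,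
`α₂ > 0`, `c₂ > 1` such that no classical unit-viscosity Navier–Stokes flow `(v, q)` on
`ℝ³ × (−∞, 0)` which on `[−1, 0)` has the rotated discretely self-similar form
`v(t, x) = (−t)^{−1/2} R(αs) U(R(−αs) x/√(−t), s)`, `s = −log(−t)` (Pineau–Vicol 2026, (1.13a);
the tree's `pvAnsatz α U`), with a `C²` profile `U(y, s)` periodic in `s` with period `2 log c`
(`c > 1`) and decaying like `‖U(y, s)‖ ≤ C₀/(1 + ‖y‖)` for `s ≥ 0`, and with
`(|α| ≤ α₁ ∧ c < c₁) ∨ (α₂ ≤ |α| ∧ c < c₂^{1/(1+α²)})`, carries a positive weighted enstrophy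
`∫ ‖curl v(t)‖² K(t) > 0` at all negative times (for ANY weight `K`).

Proof.  Restrict the solution to the printed time set `[−1, 0)` (`IsClassicalNSSolutionOn.mono`);
the profile decay for `s ≥ 0` gives the Type I bound (1.10) with the same constant (Remark 1.2,
`PineauVicol2026.typeI_of_norm_profile_le`).  Pineau–Vicol 2026, Thm. 1.7 — PROVED in the tree
as `pineauVicol2026_rdss_liouville_holds` — forces `U(y, s) = 0` for `s ∈ [0, 2 log c]`, in
particular `U(·, 0) = 0`; but `v(−1) = U(·, 0)` (`pvAnsatz_neg_one`: at `t = −1`, `s = 0` and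
`R(0) = 1`), so `v(−1) = 0`, `curl v(−1) ≡ 0`, and the weighted enstrophy at `t = −1` vanishes,
contradicting its positivity.

## References

* B. Pineau, V. Vicol, *On rotated backwards self-similar solutions of the incompressible 3D
  Navier–Stokes equations*, arXiv:2607.09619 (2026), Theorem 1.7 (p. 7), Remark 1.2 (pp. 3–4),
  Remark 1.3 (p. 4).  [PineauVicol2026]
-/

noncomputable section

-- the registered stub namespace repeats the summit name `NavierStokesRegularity` (summit = problem)
set_option linter.dupNamespace false

namespace Summit.NavierStokesRegularity.NavierStokesRegularity.Theorems.FrequencyRigidity.ScaledEnergySplit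

open Literature.Analysis.FluidPDE MeasureTheory Set Filter Topology Function
open scoped ContDiff

/-! ## Bookkeeping: an RDSS flow on `(−∞, 0)` seen on Pineau–Vicol's time set `[−1, 0)` -/

variable {α c C₀ : ℝ} {U : EuclideanSpace ℝ (Fin 3) → ℝ → EuclideanSpace ℝ (Fin 3)}
  {v : ℝ → EuclideanSpace ℝ (Fin 3) → EuclideanSpace ℝ (Fin 3)}

/-- **Remark 1.2 of the source, (1.9) for `s ≥ 0` ⇒ (1.10).** An RDSS flow on `[−1, 0)` whose
profile decays like `‖U(y, s)‖ ≤ C₀/(1 + ‖y‖)` for all self-similar times `s ≥ 0` obeys the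
Type I bound `‖v(t, x)‖ ≤ C₀/(‖x‖ + √(−t))` on `ℝ³ × [−1, 0)`, with the same constant
(`PineauVicol2026.typeI_of_norm_profile_le`). [cite: PineauVicol2026, Remark 1.2 (pp. 3–4)] -/
theorem rdssExtremes_typeI_of_decay
    (hA : ∀ t ∈ Ico (-1 : ℝ) 0, ∀ x, v t x = pvAnsatz α U t x)
    (hdec : ∀ (y : EuclideanSpace ℝ (Fin 3)) (s : ℝ), 0 ≤ s → ‖U y s‖ ≤ C₀ / (1 + ‖y‖)) :
    ∀ t ∈ Ico (-1 : ℝ) 0, ∀ x, ‖v t x‖ ≤ C₀ / (‖x‖ + Real.sqrt (-t)) := by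
  intro t ht x
  rw [hA t ht x]
  exact PineauVicol2026.typeI_of_norm_profile_le (α := α) hdec t ht x

/-- At `t = −1` (`s = 0`, `R(0) = 1`) an RDSS flow IS its initial profile slice:
`v(−1) = U(·, 0)` (`pvAnsatz_neg_one`). [cite: PineauVicol2026, Remark 1.3 (p. 4)] -/
theorem rdssExtremes_slice_neg_one
    (hA : ∀ t ∈ Ico (-1 : ℝ) 0, ∀ x, v t x = pvAnsatz α U t x) : v (-1) = fun x => U x 0 :=
  funext fun x => by rw [hA (-1) (by norm_num) x, pvAnsatz_neg_one]

/-- An RDSS flow whose profile vanishes on the period window `[0, 2 log c]` (`c > 1`, so the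
window contains `s = 0`) vanishes at `t = −1`. [folklore] -/
theorem rdssExtremes_neg_one_eq_zero (hc : 1 < c)
    (hA : ∀ t ∈ Ico (-1 : ℝ) 0, ∀ x, v t x = pvAnsatz α U t x)
    (hU0 : ∀ (y : EuclideanSpace ℝ (Fin 3)), ∀ s ∈ Icc (0 : ℝ) (2 * Real.log c), U y s = 0) :
    v (-1) = fun _ => 0 := by
  rw [rdssExtremes_slice_neg_one hA]
  funext x
  exact hU0 x 0 ⟨le_rfl, by positivity [Real.log_pos hc]⟩

/-- Hence an RDSS flow whose profile vanishes on the period window is irrotational at `t = −1`: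
`curl v(−1) ≡ 0` (`curl 0 = 0`). [folklore] -/
theorem rdssExtremes_curl_neg_one_eq_zero (hc : 1 < c)
    (hA : ∀ t ∈ Ico (-1 : ℝ) 0, ∀ x, v t x = pvAnsatz α U t x)
    (hU0 : ∀ (y : EuclideanSpace ℝ (Fin 3)), ∀ s ∈ Icc (0 : ℝ) (2 * Real.log c), U y s = 0)
    (x : EuclideanSpace ℝ (Fin 3)) : curl (v (-1)) x = 0 := by
  rw [rdssExtremes_neg_one_eq_zero hc hA hU0]
  simp [curl]

/-! ## The stub -/

/-- **Stub `stub_finiteRDSSExtremes` (Stub 2 of the line `scaled-energy-split`, RDSS case):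
the rotated discretely self-similar case inside Pineau–Vicol's `λ ≈ 1` windows is CLOSED.**
For every decay constant `C₀ > 0` there are `α₁ > 0`, `c₁ > 1`, `α₂ > 0`, `c₂ > 1` — the
thresholds of Pineau–Vicol 2026, Thm. 1.7 (`pineauVicol2026_rdss_liouville_holds`, proved in the
tree) — such that no classical unit-viscosity flow `(v, q)` on `(−∞, 0)` which is
`(α, c)`-RDSS on `[−1, 0)`, `v = pvAnsatz α U` with a `C²` profile `U` of period `2 log c` in `s`
and decay `‖U(y, s)‖ ≤ C₀/(1 + ‖y‖)` (`s ≥ 0`), and with `(|α| ≤ α₁ ∧ c < c₁)` or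
`(α₂ ≤ |α| ∧ c < c₂^{1/(1+α²)})`, has positive weighted enstrophy `∫ ‖curl v(t)‖² K(t) > 0` for
all `t < 0` (any weight `K`): on `[−1, 0)` the flow is a classical Type I (constant `C₀`,
Remark 1.2) RDSS solution, so Thm. 1.7 gives `U ≡ 0` on `ℝ³ × [0, 2 log c]`, whence
`v(−1) = U(·, 0) = 0`, `curl v(−1) ≡ 0`, and the weighted enstrophy at `t = −1` is `0`.
[cite: PineauVicol2026, Theorem 1.7 (arXiv:2607.09619 p. 7)] -/
theorem stub_finiteRDSSExtremes : ∀ C₀ : ℝ, 0 < C₀ → ∃ α₁ c₁ α₂ c₂ : ℝ, 0 < α₁ ∧ 1 < c₁ ∧ 0 < α₂ ∧ 1 < c₂ ∧ ∀ (α c : ℝ) (U : EuclideanSpace ℝ (Fin 3) → ℝ → EuclideanSpace ℝ (Fin 3)) (v : ℝ → EuclideanSpace ℝ (Fin 3) → EuclideanSpace ℝ (Fin 3)) (q : ℝ → EuclideanSpace ℝ (Fin 3) → ℝ) (K : ℝ → EuclideanSpace ℝ (Fin 3) → ℝ), Literature.Analysis.FluidPDE.IsClassicalNSSolutionOn (Set.Iio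 0) 1 0 v q → 1 < c → ContDiff ℝ 2 (fun p : EuclideanSpace ℝ (Fin 3) × ℝ => U p.1 p.2) → (∀ (y : EuclideanSpace ℝ (Fin 3)) (s : ℝ), U y (s + 2 * Real.log c) = U y s) → (∀ t ∈ Set.Ico (-1:ℝ) 0, ∀ x, v t x = Literature.Analysis.FluidPDE.pvAnsatz α U t x) → (∀ (y : EuclideanSpace ℝ (Fin 3)) (s : ℝ), 0 ≤ s → ‖U y s‖ ≤ C₀ / (1 + ‖y‖)) → (∀ t ∈ Set.Iio (0:ℝ), 0 < ∫ x, ‖Literature.Analysis.FluidPDE.curl (v t) x‖ ^ 2 * K t x) → ((|α| ≤ α₁ ∧ c < c₁) ∨ (α₂ ≤ |α| ∧ c < c₂ ^ (1 / (1 + α ^ 2)))) → False := by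
  intro C₀ hC₀
  -- Pineau–Vicol 2026, Thm. 1.7 (proved in the tree): both windows, for this `C₀`
  obtain ⟨⟨α₁, c₁, hα₁, hc₁, hPV₁⟩, ⟨α₂, c₂, hα₂, hc₂, hPV₂⟩⟩ :=
    pineauVicol2026_rdss_liouville_holds C₀ hC₀
  refine ⟨α₁, c₁, α₂, c₂, hα₁, hc₁, hα₂, hc₂,
    fun α c U v q K hsol hc hU2 hper hA hdec hH hαc => ?_⟩
  -- on `[−1, 0)` (a set of unique differentiability, `uniqueDiffOn_Ico`): classical
  -- (`IsClassicalNSSolutionOn.mono`), Type I with constant `C₀`, RDSS with the `C²` periodic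
  -- profile `U`
  have hsol' : IsClassicalNSSolutionOn (Ico (-1 : ℝ) 0) 1 0 v q :=
    hsol.mono Ico_subset_Iio_self (uniqueDiffOn_Ico (-1) 0)
  have hI := rdssExtremes_typeI_of_decay hA hdec
  have hU0 : ∀ (y : EuclideanSpace ℝ (Fin 3)), ∀ s ∈ Icc (0 : ℝ) (2 * Real.log c), U y s = 0 := by
    rcases hαc with ⟨hα, hcc⟩ | ⟨hα, hcc⟩
    · exact hPV₁ α c v q U hα hc hcc hsol' hI hU2 hper hA
    · exact hPV₂ α c v q U hα hc hcc hsol' hI hU2 hper hA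
  -- hence the weighted enstrophy at `t = −1` vanishes, contradicting its positivity
  have h1 := hH (-1) (by norm_num)
  simp [rdssExtremes_curl_neg_one_eq_zero hc hA hU0] at h1

end Summit.NavierStokesRegularity.NavierStokesRegularity.Theorems.FrequencyRigidity.ScaledEnergySplit

end
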